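import Summits.ABC.ABC.Statement
import Literature.NumberTheory.DiophantineGeometry.AbcWave0QualityFormProofs
import HarnessLib

/-!
# The fourth-power corner of the first open support (solo-ABC-blind, generation 5)

Companion to `SoloBlindSquareCorner`.  On the support `{2, p, q}` the shape `1 + b = q⁴` (`q` prime,
`#(b·q⁴).primeFactors ≤ 3`) has exactly the two triples `1 + 15 = 2⁴` and `1 + 80 = 3⁴`: for a prime
`q ≥ 5` the three numbers `2`, `3` (which divides `q² - 1`) and any prime factor of the odd number
`(q² + 1)/2` are distinct prime factors of `q⁴ - 1`, so `ω ≥ 4`.  Hence abc holds on this corner with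
`(ε, C) = (0, 27/10)`, sharp at `1 + 80 = 81` (`rad = 30`).  Elementary (Zsigmondy-type count); no
Mihăilescu needed here.  [folklore]
-/

open UniqueFactorizationMonoid Finset

namespace Summit.ABC.ABC.Theorems

open Literature.NumberTheory.DiophantineGeometry

/-- **The fourth-power corner is finite and explicit:** `q` prime, `b + 1 = q⁴`, `#(1·b·q⁴).primeFactors ≤ 3`
force `q = 2` or `q = 3` (the triples `1 + 15 = 16`, `1 + 80 = 81`). [folklore] -/
theorem fourth_corner {b q : ℕ} (hq : q.Prime) (hbq : b + 1 = q ^ 4)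
    (hω : (1 * b * q ^ 4).primeFactors.card ≤ 3) : q = 2 ∨ q = 3 := by
  have hq2 := hq.two_le
  by_contra hne
  push Not at hne
  have hq5 : 5 ≤ q := by
    rcases Nat.lt_or_ge q 5 with h | h
    · exfalso
      have h4 : q = 4 := by omega
      exact absurd (h4 ▸ hq) (by decide)
    · exact h
  have hq4 : 16 ≤ q ^ 4 := le_trans (by norm_num) (Nat.pow_le_pow_left hq2 4)
  have hb0 : b ≠ 0 := by omega
  -- `u = q² - 1`, `b = u (u + 2)`
  obtain ⟨u, hu⟩ : ∃ u, u + 1 = q ^ 2 :=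
    ⟨q ^ 2 - 1, by have : 1 ≤ q ^ 2 := Nat.one_le_pow 2 q hq.pos; omega⟩
  have hb : b = u * (u + 2) := by
    have h := hbq
    have h2 : q ^ 4 = (u + 1) ^ 2 := by rw [hu]; ring
    rw [h2] at h
    ring_nf at h ⊢
    linarith
  -- `3 ∣ u`
  have h3q : ¬ 3 ∣ q := by
    intro h
    have := (Nat.prime_dvd_prime_iff_eq Nat.prime_three hq).mp h
    omega
  have h3u : 3 ∣ u := by
    rcases (by omega : q % 3 = 1 ∨ q % 3 = 2) with h | h
    · obtain ⟨k, hk⟩ : ∃ k, q = 3 * k + 1 := ⟨q / 3, by omega⟩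
      subst hk
      refine ⟨3 * k ^ 2 + 2 * k, ?_⟩
      ring_nf at hu ⊢
      linarith
    · obtain ⟨k, hk⟩ : ∃ k, q = 3 * k + 2 := ⟨q / 3, by omega⟩
      subst hk
      refine ⟨3 * k ^ 2 + 4 * k + 1, ?_⟩
      ring_nf at hu ⊢
      linarith
  -- `u + 2 = 2 y` with `y` odd, and an odd prime `r ∣ y`, `r ≠ 3`
  obtain ⟨j, hj⟩ := hq.odd_of_ne_two (by omega)
  have hy : u + 2 = 2 * (2 * j ^ 2 + 2 * j + 1) := by
    subst hj
    ring_nf at hu ⊢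
    linarith
  have hy1 : 2 * j ^ 2 + 2 * j + 1 ≠ 1 := by
    have : 1 ≤ j := by omega
    nlinarith
  obtain ⟨r, hr, hry⟩ := Nat.exists_prime_and_dvd hy1
  have hr2 : r ≠ 2 := by
    rintro rfl
    have : (2 : ℕ) ∣ 1 := by
      have h2 : 2 ∣ 2 * j ^ 2 + 2 * j := ⟨j ^ 2 + j, by ring⟩
      exact (Nat.dvd_add_right h2).mp hry
    omega
  have hrw : r ∣ u + 2 := by rw [hy]; exact hry.mul_left 2
  have hr3 : r ≠ 3 := by
    rintro rfl
    have : 3 ∣ 2 := (Nat.dvd_add_right h3u).mp hrw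
    omega
  have h2u : 2 ∣ u := by
    have : 2 ∣ u + 2 := by rw [hy]; exact dvd_mul_right 2 _
    omega
  -- three distinct primes in `b`, a fourth (`q`) in `b q⁴`
  have hmem : ∀ d, d.Prime → d ∣ b → d ∈ b.primeFactors := fun d hd hdb =>
    Nat.mem_primeFactors.mpr ⟨hd, hdb, hb0⟩
  have h2b := hmem 2 Nat.prime_two (by rw [hb]; exact h2u.mul_right _)
  have h3b := hmem 3 Nat.prime_three (by rw [hb]; exact h3u.mul_right _)
  have hrb := hmem r hr (by rw [hb]; exact hrw.mul_left _)
  have hcard3 : 3 ≤ b.primeFactors.card := by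
    have h3 : ({2, 3, r} : Finset ℕ).card = 3 :=
      Finset.card_eq_three.mpr ⟨2, 3, r, by norm_num, hr2.symm, hr3.symm, rfl⟩
    have hsub3 : ({2, 3, r} : Finset ℕ) ⊆ b.primeFactors := by
      intro x hx
      simp only [Finset.mem_insert, Finset.mem_singleton] at hx
      rcases hx with rfl | rfl | rfl
      exacts [h2b, h3b, hrb]
    have := Finset.card_le_card hsub3
    omega
  have hq0 : q ^ 4 ≠ 0 := by positivity
  have hsub : b.primeFactors ⊆ (1 * b * q ^ 4).primeFactors := by
    rw [one_mul]; exact Nat.primeFactors_mono (dvd_mul_right b _) (mul_ne_zero hb0 hq0)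
  have hqmem : q ∈ (1 * b * q ^ 4).primeFactors := by
    rw [one_mul]
    exact Nat.mem_primeFactors.mpr ⟨hq, (dvd_pow_self q four_ne_zero).mul_left b, mul_ne_zero hb0 hq0⟩
  have hqnot : q ∉ b.primeFactors := by
    intro hm
    have hdvd := (Nat.mem_primeFactors.mp hm).2.1
    have h1 : q ∣ 1 := by
      have : q ∣ b + 1 := by rw [hbq]; exact dvd_pow_self q four_ne_zero
      exact (Nat.dvd_add_right hdvd).mp this
    exact absurd (Nat.le_of_dvd one_pos h1) (by omega)
  have hne' : b.primeFactors ≠ (1 * b * q ^ 4).primeFactors := by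
    intro h; rw [h] at hqnot; exact hqnot hqmem
  have hlt := Finset.card_lt_card (lt_of_le_of_ne hsub hne')
  omega

/-- The two triples of the corner, with their supports: `rad(1·15·16) = rad(1·80·81) = 30`. [folklore] -/
theorem fourth_corner_examples :
    (IsABCTriple 1 15 (2 ^ 4) ∧ (1 * 15 * 2 ^ 4).primeFactors.card = 3 ∧ rad 1 15 (2 ^ 4) = 30) ∧
    (IsABCTriple 1 80 (3 ^ 4) ∧ (1 * 80 * 3 ^ 4).primeFactors.card = 3 ∧ rad 1 80 (3 ^ 4) = 30) := by
  have h5 : Nat.Prime 5 := by norm_num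
  have hpf1 : (1 * 15 * 2 ^ 4 : ℕ).primeFactors = {3, 5, 2} := by
    rw [show (1 * 15 * 2 ^ 4 : ℕ) = (3 ^ 1 * 5 ^ 1) * 2 ^ 4 by norm_num,
      Nat.primeFactors_mul (by norm_num) (by norm_num), Nat.primeFactors_mul (by norm_num) (by norm_num),
      Nat.primeFactors_prime_pow (by norm_num) Nat.prime_three,
      Nat.primeFactors_prime_pow (by norm_num) h5,
      Nat.primeFactors_prime_pow (by norm_num) Nat.prime_two]
    decide
  have hpf2 : (1 * 80 * 3 ^ 4 : ℕ).primeFactors = {2, 5, 3} := by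
    rw [show (1 * 80 * 3 ^ 4 : ℕ) = (2 ^ 4 * 5 ^ 1) * 3 ^ 4 by norm_num,
      Nat.primeFactors_mul (by norm_num) (by norm_num), Nat.primeFactors_mul (by norm_num) (by norm_num),
      Nat.primeFactors_prime_pow (by norm_num) Nat.prime_two,
      Nat.primeFactors_prime_pow (by norm_num) h5,
      Nat.primeFactors_prime_pow (by norm_num) Nat.prime_three]
    decide
  refine ⟨⟨⟨by norm_num, by norm_num, by norm_num, by decide⟩, by rw [hpf1]; decide, ?_⟩,
    ⟨⟨by norm_num, by norm_num, by norm_num, by decide⟩, by rw [hpf2]; decide, ?_⟩⟩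
  · rw [rad_def, Nat.radical_eq_prod_primeFactors, hpf1]; decide
  · rw [rad_def, Nat.radical_eq_prod_primeFactors, hpf2]; decide

/-- **abc on the fourth-power corner:** `10·q⁴ ≤ 27·rad(1, b, q⁴)`, i.e. `c ≤ 2.7·rad`, sharp at `1 + 80 = 81`.
[folklore] -/
theorem fourth_corner_le {b q : ℕ} (hq : q.Prime) (hbq : b + 1 = q ^ 4)
    (hω : (1 * b * q ^ 4).primeFactors.card ≤ 3) : 10 * q ^ 4 ≤ 27 * rad 1 b (q ^ 4) := by
  rcases fourth_corner hq hbq hω with rfl | rfl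
  · obtain rfl : b = 15 := by omega
    rw [fourth_corner_examples.1.2.2]; norm_num
  · obtain rfl : b = 80 := by omega
    rw [fourth_corner_examples.2.2.2]; norm_num

end Summit.ABC.ABC.Theorems
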